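import Mathlib
import Literature.Barriers.MatrixMultiplication.NormalizerBarrier
import Summits.MatrixMultiplication.MatrixMultiplication.Theorems.LieRankDesigns.Negative.Basics
import Summits.MatrixMultiplication.MatrixMultiplication.Theorems.SubgroupIdentityDesigns.Negative.StandardLines

/-!
# The SCALAR LAW for subgroup-TPP triples in `GL_m(𝔽_p)` (all `p`, all `m ≥ 1`, all levels)

Route `LevelGradedCohnUmans`, crux `SubgroupIdentityDesigns` (stmt-MatrixMultiplication-14079),
negative side.  Every witness of the crux is a subgroup-TPP triple `(H₁, H₂, H₃)` of
`GL_m(𝔽_p)`; this file records the one constraint the CENTRE imposes on such a triple, with no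
hypothesis on `p`, `m`, the level `k` or the design:

* `coprime_card_of_disjoint` — two DISJOINT subgroups of a finite cyclic group have COPRIME orders
  (the multiplication map `A × B → C` is injective and lands in `{x | x ^ lcm(|A|,|B|) = 1}`, a set
  of size `≤ lcm` in a cyclic group; so `|A||B| ≤ lcm(|A|,|B|)`, i.e. `gcd = 1`);
* `scalarHom p m : 𝔽_pˣ →* GL_m(𝔽_p)` (the scalar matrices) and the SCALAR PARTS
  `Sᵢ = Hᵢ.comap (scalarHom p m) ≤ 𝔽_pˣ`;
* `scalar_law` — **if `SubgroupTPP H₁ H₂ H₃` then `|S₁| · |S₂| · |S₃| ∣ p - 1`** (the scalar parts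
  are pairwise disjoint subgroups of the cyclic group `𝔽_pˣ`, hence of pairwise coprime orders,
  each dividing `p - 1`);
* `scalar_mem_atMostOne` — a scalar `≠ 1` lies in at most one member; in particular `-1` lies in
  at most one member when `p ≠ 2` (`neg_one_mem_atMostOne`);
* `volume_le_of_scalar_index` — the arithmetic corollary used by the profile sieve of the `(2,1)`
  cell: if `|Hᵢ| ≤ |Sᵢ| · Nᵢ` (`Nᵢ` a bound for the image of `Hᵢ` in `PGL`), then
  `|H₁||H₂||H₃| ≤ (p - 1) · N₁ N₂ N₃`.

This corrects the informal claim "TPP ⇒ at most one member meets the centre non-trivially"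
(false: `(⟨-1⟩, ⟨ω·1⟩, 1)` with `ω` of odd order is subgroup-TPP); the right statement is the
divisibility `|S₁||S₂||S₃| ∣ p - 1` with pairwise coprime factors.
VALUE = THEOREM (a constraint on every witness), NOT summit progress; the crux item is untouched
and remains open.  Report: `run/shared/lean/b2b/levelgraded-cu/ORACLE-g16.md` §G16-1.
-/

set_option linter.dupNamespace false

noncomputable section

open scoped BigOperators Classical

open Summit.MatrixMultiplication.MatrixMultiplication.Theorems.LieRankDesigns.Negative (GLm Mat)

open Literature.Barriers.MatrixMultiplication (SubgroupTPP)

namespace Summit.MatrixMultiplication.MatrixMultiplication.Theorems.SubgroupIdentityDesigns.Negative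

section Cyclic

/-- **Disjoint subgroups of a finite cyclic group have coprime orders.**  The multiplication map
`A × B → C` is injective (disjointness) with image inside `{x | x ^ lcm(|A|,|B|) = 1}`, which in a
cyclic group has at most `lcm(|A|,|B|)` elements; hence `|A| |B| ≤ lcm(|A|,|B|)` and
`gcd(|A|,|B|) = 1`. [folklore] -/
theorem coprime_card_of_disjoint {C : Type*} [CommGroup C] [Finite C] [IsCyclic C]
    {A B : Subgroup C} (hAB : Disjoint A B) : Nat.Coprime (Nat.card A) (Nat.card B) := by
  classical
  letI := Fintype.ofFinite C
  set L := Nat.lcm (Nat.card A) (Nat.card B) with hL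
  have hApos : 0 < Nat.card A := Nat.card_pos
  have hBpos : 0 < Nat.card B := Nat.card_pos
  have hLpos : 0 < L := Nat.lcm_pos hApos hBpos
  have hpowA : ∀ a : A, (a : C) ^ L = 1 := by
    intro a
    obtain ⟨k, hk⟩ := Nat.dvd_lcm_left (Nat.card A) (Nat.card B)
    have h1 : (a : C) ^ Nat.card A = 1 :=
      orderOf_dvd_iff_pow_eq_one.mp (by rw [Subgroup.orderOf_coe]; exact orderOf_dvd_natCard a)
    rw [show L = Nat.card A * k from hk, pow_mul, h1, one_pow]
  have hpowB : ∀ b : B, (b : C) ^ L = 1 := by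
    intro b
    obtain ⟨k, hk⟩ := Nat.dvd_lcm_right (Nat.card A) (Nat.card B)
    have h1 : (b : C) ^ Nat.card B = 1 :=
      orderOf_dvd_iff_pow_eq_one.mp (by rw [Subgroup.orderOf_coe]; exact orderOf_dvd_natCard b)
    rw [show L = Nat.card B * k from hk, pow_mul, h1, one_pow]
  let f : A × B → {x : C // x ^ L = 1} := fun ab =>
    ⟨(ab.1 : C) * (ab.2 : C), by rw [mul_pow, hpowA, hpowB, one_mul]⟩
  have hinj : Function.Injective f := by
    intro x y hxy
    exact Subgroup.mul_injective_of_disjoint hAB (congrArg Subtype.val hxy)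
  have hcard : Nat.card A * Nat.card B ≤ Nat.card {x : C // x ^ L = 1} := by
    rw [← Nat.card_prod]
    exact Nat.card_le_card_of_injective f hinj
  have hsub : Nat.card {x : C // x ^ L = 1} ≤ L := by
    rw [Nat.card_eq_fintype_card, Fintype.card_subtype]
    exact IsCyclic.card_pow_eq_one_le hLpos
  have hgl : Nat.gcd (Nat.card A) (Nat.card B) * L = Nat.card A * Nat.card B := Nat.gcd_mul_lcm _ _
  have hle : Nat.gcd (Nat.card A) (Nat.card B) * L ≤ 1 * L := by
    rw [hgl, one_mul]; exact hcard.trans hsub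
  have hg1 : Nat.gcd (Nat.card A) (Nat.card B) ≤ 1 := Nat.le_of_mul_le_mul_right hle hLpos
  have hg0 : 0 < Nat.gcd (Nat.card A) (Nat.card B) := Nat.gcd_pos_of_pos_left _ hApos
  show Nat.gcd (Nat.card A) (Nat.card B) = 1
  omega

end Cyclic

section Scalar

variable {p : ℕ} [hp : Fact p.Prime] {m : ℕ}

/-- The scalar matrices: `𝔽_pˣ →* GL_m(𝔽_p)`, `u ↦ u · 1`. -/
def scalarHom (p m : ℕ) : (ZMod p)ˣ →* GLm p m :=
  Units.map (Matrix.scalar (Fin m) : ZMod p →+* Mat p m).toMonoidHom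

/-- The underlying matrix of `scalarHom p m u` is the scalar matrix `u · 1`. -/
@[simp] theorem coe_scalarHom (u : (ZMod p)ˣ) :
    ((scalarHom p m u : GLm p m) : Mat p m) = Matrix.scalar (Fin m) (u : ZMod p) := rfl

/-- The scalar embedding is injective for `m ≥ 1`. -/
theorem scalarHom_injective [NeZero m] : Function.Injective (scalarHom p m) := by
  intro u v h
  have h' := congrArg (fun g : GLm p m => (g : Mat p m)) h
  simp only [coe_scalarHom] at h'
  exact Units.ext (Matrix.scalar_inj.mp h')

/-- Scalars are central in `GL_m(𝔽_p)`. -/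
theorem scalarHom_comm (u : (ZMod p)ˣ) (g : GLm p m) :
    scalarHom p m u * g = g * scalarHom p m u := by
  apply Units.ext
  change Matrix.scalar (Fin m) (u : ZMod p) * (g : Mat p m) =
    (g : Mat p m) * Matrix.scalar (Fin m) (u : ZMod p)
  exact (Matrix.scalar_commute (u : ZMod p) (fun r' => Commute.all _ _) (g : Mat p m)).eq

/-- Disjoint subgroups have disjoint scalar parts (`m ≥ 1`). -/
theorem disjoint_comap_scalarHom [NeZero m] {H K : Subgroup (GLm p m)} (h : Disjoint H K) :
    Disjoint (H.comap (scalarHom p m)) (K.comap (scalarHom p m)) := by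
  rw [Subgroup.disjoint_def] at h ⊢
  intro x hx hx'
  rw [Subgroup.mem_comap] at hx hx'
  exact scalarHom_injective (by rw [map_one]; exact h hx hx')

/-- The order of a subgroup of `𝔽_pˣ` divides `p - 1`. -/
theorem card_subgroup_units_dvd (S : Subgroup (ZMod p)ˣ) : Nat.card S ∣ p - 1 := by
  have h := S.card_subgroup_dvd_card
  rwa [Nat.card_eq_fintype_card (α := (ZMod p)ˣ), ZMod.card_units p] at h

/-- **THE SCALAR LAW.**  For a subgroup-TPP triple in `GL_m(𝔽_p)` (`m ≥ 1`), the scalar parts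
`Sᵢ = Hᵢ ∩ Z` are pairwise disjoint subgroups of the cyclic group `𝔽_pˣ`, hence have pairwise
coprime orders, and `|S₁| · |S₂| · |S₃| ∣ p - 1`.  All `p`, all `m ≥ 1`; no design and no level
hypothesis. -/
theorem scalar_law [NeZero m] {H₁ H₂ H₃ : Subgroup (GLm p m)} (htpp : SubgroupTPP H₁ H₂ H₃) :
    Nat.Coprime (Nat.card (H₁.comap (scalarHom p m))) (Nat.card (H₂.comap (scalarHom p m))) ∧
    Nat.Coprime (Nat.card (H₁.comap (scalarHom p m))) (Nat.card (H₃.comap (scalarHom p m))) ∧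
    Nat.Coprime (Nat.card (H₂.comap (scalarHom p m))) (Nat.card (H₃.comap (scalarHom p m))) ∧
    Nat.card (H₁.comap (scalarHom p m)) * Nat.card (H₂.comap (scalarHom p m)) *
      Nat.card (H₃.comap (scalarHom p m)) ∣ p - 1 := by
  obtain ⟨d₁₂, d₁₃, d₂₃⟩ := StandardLines.subgroupTPP_disjoint htpp
  have c₁₂ := coprime_card_of_disjoint (disjoint_comap_scalarHom d₁₂)
  have c₁₃ := coprime_card_of_disjoint (disjoint_comap_scalarHom d₁₃)
  have c₂₃ := coprime_card_of_disjoint (disjoint_comap_scalarHom d₂₃)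
  refine ⟨c₁₂, c₁₃, c₂₃, ?_⟩
  have c₁₂₃ : Nat.Coprime (Nat.card (H₁.comap (scalarHom p m)) * Nat.card (H₂.comap (scalarHom p m)))
      (Nat.card (H₃.comap (scalarHom p m))) := Nat.coprime_mul_iff_left.mpr ⟨c₁₃, c₂₃⟩
  exact Nat.Coprime.mul_dvd_of_dvd_of_dvd c₁₂₃
    (Nat.Coprime.mul_dvd_of_dvd_of_dvd c₁₂ (card_subgroup_units_dvd _) (card_subgroup_units_dvd _))
    (card_subgroup_units_dvd _)

/-- The product form most often used: `|S₁| · |S₂| · |S₃| ≤ p - 1`. -/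
theorem scalar_card_mul_le [NeZero m] {H₁ H₂ H₃ : Subgroup (GLm p m)}
    (htpp : SubgroupTPP H₁ H₂ H₃) :
    Nat.card (H₁.comap (scalarHom p m)) * Nat.card (H₂.comap (scalarHom p m)) *
      Nat.card (H₃.comap (scalarHom p m)) ≤ p - 1 :=
  Nat.le_of_dvd (Nat.sub_pos_of_lt hp.out.one_lt) (scalar_law htpp).2.2.2

/-- A scalar `≠ 1` lies in AT MOST ONE member of a subgroup-TPP triple (`m ≥ 1`). -/
theorem scalar_mem_atMostOne [NeZero m] {H₁ H₂ H₃ : Subgroup (GLm p m)}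
    (htpp : SubgroupTPP H₁ H₂ H₃) {u : (ZMod p)ˣ} (hu : u ≠ 1) :
    ¬ (scalarHom p m u ∈ H₁ ∧ scalarHom p m u ∈ H₂) ∧
    ¬ (scalarHom p m u ∈ H₁ ∧ scalarHom p m u ∈ H₃) ∧
    ¬ (scalarHom p m u ∈ H₂ ∧ scalarHom p m u ∈ H₃) := by
  obtain ⟨d₁₂, d₁₃, d₂₃⟩ := StandardLines.subgroupTPP_disjoint htpp
  have key : ∀ {H K : Subgroup (GLm p m)}, Disjoint H K →
      ¬ (scalarHom p m u ∈ H ∧ scalarHom p m u ∈ K) := by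
    intro H K hd ⟨h1, h2⟩
    have := Subgroup.disjoint_def.mp hd h1 h2
    exact hu (scalarHom_injective (by rw [map_one]; exact this))
  exact ⟨key d₁₂, key d₁₃, key d₂₃⟩

/-- `-1` as a unit of `𝔽_p` is `≠ 1` when `p ≠ 2`. -/
theorem neg_one_ne_one_units (hp2 : p ≠ 2) : (-1 : (ZMod p)ˣ) ≠ 1 := by
  intro h
  have h' : ((-1 : (ZMod p)ˣ) : ZMod p) = ((1 : (ZMod p)ˣ) : ZMod p) := by rw [h]
  rw [Units.val_neg, Units.val_one] at h'
  have h2 : (2 : ZMod p) = 0 := by linear_combination -h'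
  have : (p : ℕ) ∣ 2 := by exact_mod_cast (ZMod.natCast_eq_zero_iff 2 p).mp (by exact_mod_cast h2)
  have := (Nat.prime_dvd_prime_iff_eq hp.out Nat.prime_two).mp this
  exact hp2 this

/-- **`-1` lies in at most one member** of a subgroup-TPP triple in `GL_m(𝔽_p)`, `p ≠ 2`, `m ≥ 1`
(the scalar `-1 = scalarHom p m (-1)`). -/
theorem neg_one_mem_atMostOne [NeZero m] (hp2 : p ≠ 2) {H₁ H₂ H₃ : Subgroup (GLm p m)}
    (htpp : SubgroupTPP H₁ H₂ H₃) :
    ¬ (scalarHom p m (-1) ∈ H₁ ∧ scalarHom p m (-1) ∈ H₂) ∧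
    ¬ (scalarHom p m (-1) ∈ H₁ ∧ scalarHom p m (-1) ∈ H₃) ∧
    ¬ (scalarHom p m (-1) ∈ H₂ ∧ scalarHom p m (-1) ∈ H₃) :=
  scalar_mem_atMostOne htpp (neg_one_ne_one_units hp2)

/-- **Volume corollary (the profile sieve's master inequality).**  If each member's order is at
most its scalar part times a bound `Nᵢ` for its image modulo scalars, then
`|H₁| |H₂| |H₃| ≤ (p - 1) · N₁ N₂ N₃`. -/
theorem volume_le_of_scalar_index [NeZero m] {H₁ H₂ H₃ : Subgroup (GLm p m)}
    (htpp : SubgroupTPP H₁ H₂ H₃) {N₁ N₂ N₃ : ℕ}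
    (h₁ : Nat.card H₁ ≤ Nat.card (H₁.comap (scalarHom p m)) * N₁)
    (h₂ : Nat.card H₂ ≤ Nat.card (H₂.comap (scalarHom p m)) * N₂)
    (h₃ : Nat.card H₃ ≤ Nat.card (H₃.comap (scalarHom p m)) * N₃) :
    Nat.card H₁ * Nat.card H₂ * Nat.card H₃ ≤ (p - 1) * (N₁ * N₂ * N₃) := by
  have hs := scalar_card_mul_le htpp
  calc Nat.card H₁ * Nat.card H₂ * Nat.card H₃
      ≤ (Nat.card (H₁.comap (scalarHom p m)) * N₁) * (Nat.card (H₂.comap (scalarHom p m)) * N₂) *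
          (Nat.card (H₃.comap (scalarHom p m)) * N₃) :=
        Nat.mul_le_mul (Nat.mul_le_mul h₁ h₂) h₃
    _ = (Nat.card (H₁.comap (scalarHom p m)) * Nat.card (H₂.comap (scalarHom p m)) *
          Nat.card (H₃.comap (scalarHom p m))) * (N₁ * N₂ * N₃) := by ring
    _ ≤ (p - 1) * (N₁ * N₂ * N₃) := Nat.mul_le_mul_right _ hs

/-- **Index bound** (the form of `|H| = |H ∩ Z| · |HZ/Z|` the sieve needs): for every
homomorphism `f` out of `GL_m(𝔽_p)` whose kernel meets `H` inside the scalars,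
`|H| ≤ |S_H| · |f(H)|` (`|H| = |H ∩ ker f| · |f(H)|` and `H ∩ ker f ↪ S_H`). -/
theorem card_le_scalar_mul_card_map [NeZero m] {Q : Type*} [Group Q] (f : GLm p m →* Q)
    (H : Subgroup (GLm p m))
    (hker : ∀ h ∈ H, f h = 1 → h ∈ (scalarHom p m).range) :
    Nat.card H ≤ Nat.card (H.comap (scalarHom p m)) * Nat.card (H.map f) := by
  classical
  let K : Subgroup H := (f.comp H.subtype).ker
  -- |H| = |K| * |H / K| and H/K ≃ f(H)
  have e1 : Nat.card H = Nat.card K * K.index := by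
    rw [mul_comm]; exact (Subgroup.index_mul_card K).symm
  have e2 : K.index = Nat.card (H.map f) := by
    rw [Subgroup.index_ker, MonoidHom.range_comp, Subgroup.range_subtype]
  -- K injects into S_H via the inverse of scalarHom on its range
  have e3 : Nat.card K ≤ Nat.card (H.comap (scalarHom p m)) := by
    have hmem : ∀ k : K, ∃ u : (ZMod p)ˣ, scalarHom p m u = ((k : H) : GLm p m) := by
      intro k
      have hk : f ((k : H) : GLm p m) = 1 := by
        have := k.2
        rw [MonoidHom.mem_ker] at this
        simpa using this
      obtain ⟨u, hu⟩ := hker _ (k : H).2 hk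
      exact ⟨u, hu⟩
    choose u hu using hmem
    let g : K → H.comap (scalarHom p m) := fun k =>
      ⟨u k, by rw [Subgroup.mem_comap, hu]; exact (k : H).2⟩
    refine Nat.card_le_card_of_injective g ?_
    intro k k' hkk'
    have : u k = u k' := congrArg Subtype.val hkk'
    apply Subtype.ext; apply Subtype.ext
    rw [← hu k, ← hu k', this]
  rw [e1, e2]
  exact Nat.mul_le_mul_right _ e3

end Scalar

end Summit.MatrixMultiplication.MatrixMultiplication.Theorems.SubgroupIdentityDesigns.Negative

end
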